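import Literature.NumberTheory.Sieve.LargestPrimeFactorCubicCprimeRoots
import Literature.NumberTheory.Sieve.LargestPrimeFactorCubicCoprimeDensity
import Literature.NumberTheory.Sieve.LargestPrimeFactorCubicLnuSeries
import Literature.NumberTheory.Sieve.LargestPrimeFactorCubicRootCountMult
import HarnessLib

/-!
# Heath-Brown 2001 (PLMS), p. 11 and §7 p. 29: `ν(r) = ∑_{N(R)=r} γ(R)ρ(R)` in root language,
# `ν(r) = γ(r) · #rootsCube r`, its multiplicativity, `l(d)ν(d)/d = lnu d`, and `|C′(r) − …| ≤ ∑_k |T(r,k) − …|`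

Topic `Literature/NumberTheory/Sieve`; a PROVED arithmetic layer (one definition with body, no named
facts) under the named fact `Irving2015_largestPrimeFactor_cubic` (`LargestPrimeFactorCubic.lean`), input
of **Lemma 7**.  Source: D. R. Heath-Brown, *The largest prime factor of `X³ + 2`*, Proc. London Math.
Soc. (3) 82 (2001) 554–596, p. 11: "`ν(R)` is the multiplicative function on ideals defined by `ν(P^e) =
N(P)/(1 + N(P))` if `N(P)` is prime, and `ν(P^e) = 0` otherwise" (so `ν(p^e) = g(p)/(1 + p⁻¹)`), and §7
p. 29: "one readily checks that `ν(r) = ∑_{N(R)=r} γ(R)ρ(R)`."  With `ρ(R) ∈ {0,1}` and the ideals of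
norm `r` with `ρ(R) = 1` in bijection with `rootsCube r` (the congruence `n ≡ k (mod r)`, `k³ ≡ 2`), the
integer-level function is

* `nuRoot r = γ(r) · #rootsCube r` (`γ` of `…CoprimeDensity`); `nuRoot_mul` (coprime multiplicativity),
  `nuRoot_prime` (`= nuP p = p g(p)/(p+1)` of `…EulerIdentity`), `nuRoot_nonneg`, `nuRoot_le`;
* **`lFun_mul_nuRoot_div`** — `l(d) ν(d)/d = lnu d` for every `d` (the prime powers `p^e`, `e ≥ 3`, and
  `4, 9` carry `l = 0`; at `p, p²` (`p ≥ 5`) `#rootsCube = g(p)` by Hensel, `…RootCountMult`), so that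
  Heath-Brown's `C₁ = (6/π²)∑_d l(d)ν(d)/d = (6/π²)∑_d lnu d` (`…LnuSeries.tsum_lnu_eq`);
* **`abs_Cprime_sub_le`** — `|C′(r) − (6/π²)M² ν(r)/r| ≤ ∑_{k ∈ rootsCube r} |T(r,k) − (6/π²)M²γ(r)/r|`
  and the summed form `sum_Icc_abs_Cprime_sub_le` over `r ≤ Q` (`= ∑` over `rootPairs Q`), ready for
  Lemma 11.

## References

* D. R. Heath-Brown, *The largest prime factor of `X³ + 2`*, Proc. London Math. Soc. (3) 82 (2001)
  554–596, p. 11 (ν), §7 pp. 27–29. [`HeathBrown2001LargestPrimeFactorCubic`]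

## Mathlib / tree search

Tree: `gammaR` (`…CoprimeDensity`), `rootsCube`, `rootPairs` (`…RootPairs`), `card_rootsCube_mul`,
`card_rootsCube_prime_pow`, `card_rootsCube_eq_cubeRootTwoCount`, `card_rootsCube_prime_le`
(`…RootCountMult`), `lFun`, `lFun_prime_pow`, `lpp`, `lOne`, `lTwo`, `nuP`, `lnu`, `lnu_apply`, `nuFun`,
`isMultiplicative_lFun` (`…LnuSeries`/`…EulerIdentity`), `Cprime_eq_sum_Tcount` (`…CprimeRoots`).
Mathlib: `Nat.Coprime.primeFactors_mul`, `Finset.prod_union`, `Nat.recOnPosPrimePosCoprime`-free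
(we use `ArithmeticFunction.IsMultiplicative` ext on prime powers via `Nat.multiplicative_factorization`-style
lemma `ArithmeticFunction.IsMultiplicative.eq_iff_eq_on_prime_powers`).
-/

noncomputable section

open Finset Real ArithmeticFunction

namespace Literature.NumberTheory.Sieve.HeathBrown2001

open CubicPrimes

/-- `ν(r) = γ(r) · #rootsCube r` (`= ∑_{N(R)=r} γ(R)ρ(R)`). [cite: HeathBrown2001LargestPrimeFactorCubic, p. 11 and §7 p. 29] -/
def nuRoot (r : ℕ) : ℝ := gammaR r * #(rootsCube r)

/-- Auxiliary fact `nuRoot_nonneg` for this file's estimates. [folklore] -/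
theorem nuRoot_nonneg (r : ℕ) : 0 ≤ nuRoot r := by
  unfold nuRoot; exact mul_nonneg (gammaR_pos_le r).1.le (Nat.cast_nonneg _)

/-- `ν(r) ≤ #rootsCube r`. [folklore] -/
theorem nuRoot_le (r : ℕ) : nuRoot r ≤ #(rootsCube r) := by
  unfold nuRoot
  calc gammaR r * #(rootsCube r) ≤ 1 * #(rootsCube r) :=
        mul_le_mul_of_nonneg_right (gammaR_pos_le r).2 (Nat.cast_nonneg _)
    _ = _ := one_mul _

/-- `γ` is multiplicative on coprime arguments. [folklore] -/
theorem gammaR_mul {m n : ℕ} (h : m.Coprime n) : gammaR (m * n) = gammaR m * gammaR n := by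
  rcases Nat.eq_zero_or_pos m with rfl | hm
  · simp [Nat.coprime_zero_left] at h; subst h; simp [gammaR]
  rcases Nat.eq_zero_or_pos n with rfl | hn
  · simp [Nat.coprime_zero_right] at h; subst h; simp [gammaR]
  unfold gammaR
  rw [Nat.Coprime.primeFactors_mul h, prod_union (Nat.Coprime.disjoint_primeFactors h)]

/-- **`ν` is multiplicative** on coprime arguments. [cite: HeathBrown2001LargestPrimeFactorCubic, p. 11] -/
theorem nuRoot_mul {m n : ℕ} (h : m.Coprime n) : nuRoot (m * n) = nuRoot m * nuRoot n := by
  unfold nuRoot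
  rw [gammaR_mul h, card_rootsCube_mul h]; push_cast; ring

/-- `γ(p^e) = p/(p+1)`. [folklore] -/
theorem gammaR_prime_pow {p : ℕ} (hp : p.Prime) {e : ℕ} (he : e ≠ 0) : gammaR (p ^ e) = (p : ℝ) / (p + 1) := by
  unfold gammaR
  rw [Nat.primeFactors_prime_pow he hp, prod_singleton]

/-- `ν(p) = p g(p)/(p+1) = nuP p`. [cite: HeathBrown2001LargestPrimeFactorCubic, p. 11] -/
theorem nuRoot_prime {p : ℕ} (hp : p.Prime) : nuRoot p = nuP p := by
  unfold nuRoot nuP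
  rw [← pow_one p, gammaR_prime_pow hp one_ne_zero, pow_one, card_rootsCube_eq_cubeRootTwoCount]
  ring

/-- `ν(p²) = nuP p` for `p ≥ 5` (Hensel). [cite: HeathBrown2001LargestPrimeFactorCubic, p. 11] -/
theorem nuRoot_prime_sq {p : ℕ} (hp : p.Prime) (h5 : 5 ≤ p) : nuRoot (p ^ 2) = nuP p := by
  unfold nuRoot nuP
  rw [gammaR_prime_pow hp two_ne_zero, card_rootsCube_prime_pow hp h5 (by norm_num)]
  ring

/-! ### `l(d)ν(d)/d = lnu d` -/

/-- The arithmetic function `d ↦ l(d)ν(d)/d`. [cite: HeathBrown2001LargestPrimeFactorCubic, p. 11 (C₁)] -/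
def lnuRoot : ArithmeticFunction ℝ :=
  ⟨fun d => lFun d * nuRoot d / d, by simp⟩

/-- Auxiliary fact `lnuRoot_apply` for this file's estimates. [folklore] -/
theorem lnuRoot_apply (d : ℕ) : lnuRoot d = lFun d * nuRoot d / d := rfl

/-- Auxiliary: `lnuRoot` is multiplicative. [folklore] -/
theorem isMultiplicative_lnuRoot : lnuRoot.IsMultiplicative := by
  refine ⟨?_, ?_⟩
  · rw [lnuRoot_apply, isMultiplicative_lFun.map_one, nuRoot, (card_rootsCube_small).1]
    simp [gammaR]
  · intro m n hmn
    rw [lnuRoot_apply, lnuRoot_apply, lnuRoot_apply, isMultiplicative_lFun.map_mul_of_coprime hmn,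
      nuRoot_mul hmn, Nat.cast_mul]
    rcases Nat.eq_zero_or_pos m with rfl | hm
    · simp
    rcases Nat.eq_zero_or_pos n with rfl | hn
    · simp
    have : (m : ℝ) ≠ 0 := by exact_mod_cast hm.ne'
    have : (n : ℝ) ≠ 0 := by exact_mod_cast hn.ne'
    field_simp

/-- The prime powers: `lnuRoot (p^e) = lnu (p^e)`. [cite: HeathBrown2001LargestPrimeFactorCubic, (2.18)–(2.19), p. 11] -/
theorem lnuRoot_prime_pow {p : ℕ} (hp : p.Prime) (e : ℕ) : lnuRoot (p ^ e) = lnu (p ^ e) := by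
  rcases Nat.eq_zero_or_pos e with rfl | he
  · rw [pow_zero, isMultiplicative_lnuRoot.map_one, lnu_one]
  rw [lnuRoot_apply, lnu_apply, lFun_prime_pow hp he.ne', nuFun_prime_pow hp he.ne']
  -- `e ≥ 3`: `lpp = 0`
  rcases le_or_gt 3 e with h3 | h3
  · have : lpp p e = 0 := by
      unfold lpp; rw [if_neg (by omega), if_neg (by omega), if_neg (by omega)]
    rw [this]; simp
  -- `e = 1` or `e = 2`
  interval_cases e
  · rw [pow_one, nuRoot_prime hp]
  · -- `e = 2`: for `p ≥ 5` Hensel; for `p = 2, 3` the factor `lpp p 2 = lTwo p = 0`… but `lTwo 2 = 0`? (`-(2-2)/(2-1) = 0`)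
    rcases lt_or_ge p 5 with hlt | h5
    · have h23 : p = 2 ∨ p = 3 := by
        have := hp.two_le; interval_cases p
        · left; rfl
        · right; rfl
        · exact absurd hp (by decide)
      have hl : lpp p 2 = 0 := by
        unfold lpp lTwo
        rcases h23 with rfl | rfl
        · norm_num [cubeRootTwoCount_two]
        · norm_num
      rw [hl]; simp
    · rw [nuRoot_prime_sq hp h5]

/-- **`l(d)ν(d)/d = lnu d`** for all `d`. [cite: HeathBrown2001LargestPrimeFactorCubic, p. 11 (C₁ = (6/π²)∑ l(d)ν(d)/d)] -/
theorem lnuRoot_eq_lnu : lnuRoot = lnu := by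
  refine (ArithmeticFunction.IsMultiplicative.eq_iff_eq_on_prime_powers _ isMultiplicative_lnuRoot _
    isMultiplicative_lnu).mpr ?_
  intro p e hp
  exact lnuRoot_prime_pow hp e

/-- Pointwise form. [folklore] -/
theorem lFun_mul_nuRoot_div (d : ℕ) : lFun d * nuRoot d / d = lnu d := by
  rw [← lnuRoot_apply, lnuRoot_eq_lnu]

/-! ### `|C′(r) − (6/π²)M²ν(r)/r| ≤ ∑_k |T(r,k) − (6/π²)M²γ(r)/r|` -/

/-- **From `C′` to the `T(r,k)`**: `|C′(r) − (6/π²)M²ν(r)/r| ≤ ∑_{k∈rootsCube r} |T(r,k) − (6/π²)M²γ(r)/r|`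
(`r ≥ 1`). [cite: HeathBrown2001LargestPrimeFactorCubic, §7 p. 29 ((7.15) ⇒ Lemma 11)] -/
theorem abs_Cprime_sub_le {r : ℕ} (hr : 0 < r) (A B M : ℕ) :
    |(Cprime r A B M : ℝ) - 6 / Real.pi ^ 2 * (M : ℝ) ^ 2 * nuRoot r / r| ≤
      ∑ k ∈ rootsCube r, |(Tcount r k A B M : ℝ) - 6 / Real.pi ^ 2 * (M : ℝ) ^ 2 * gammaR r / r| := by
  rw [Cprime_eq_sum_Tcount hr]
  push_cast
  have h : (∑ k ∈ rootsCube r, (Tcount r k A B M : ℝ)) - 6 / Real.pi ^ 2 * (M : ℝ) ^ 2 * nuRoot r / r =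
      ∑ k ∈ rootsCube r, ((Tcount r k A B M : ℝ) - 6 / Real.pi ^ 2 * (M : ℝ) ^ 2 * gammaR r / r) := by
    rw [sum_sub_distrib, sum_const, nsmul_eq_mul, nuRoot]; ring
  rw [h]
  exact abs_sum_le_sum_abs _ _

/-- Summed over `1 ≤ r ≤ Q`: `∑_{r≤Q} |C′(r) − (6/π²)M²ν(r)/r| ≤ ∑_{(r,k)∈rootPairs Q} |T(r,k) − (6/π²)M²γ(r)/r|`.
[cite: HeathBrown2001LargestPrimeFactorCubic, §7 p. 29] -/
theorem sum_Icc_abs_Cprime_sub_le (Q A B M : ℕ) :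
    ∑ r ∈ Icc 1 Q, |(Cprime r A B M : ℝ) - 6 / Real.pi ^ 2 * (M : ℝ) ^ 2 * nuRoot r / r| ≤
      ∑ qk ∈ rootPairs Q, |(Tcount qk.1 qk.2 A B M : ℝ) - 6 / Real.pi ^ 2 * (M : ℝ) ^ 2 * gammaR qk.1 / qk.1| := by
  unfold rootPairs
  rw [sum_sigma]
  refine sum_le_sum fun r hr => ?_
  rw [mem_Icc] at hr
  exact abs_Cprime_sub_le (by omega) A B M

end Literature.NumberTheory.Sieve.HeathBrown2001
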